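import Mathlib
import HarnessLib

/-!
# Finite modifications inside `R[1/t]` are blow-ups — the ALGEBRA (Abbes–Saito 2011, Prop. 2.16, part 1/2)
# (crux `WildQuotients.WildQuotientResolution`, stub `stub_phaseZeroHighDim`: first brick of the port of (H1))

Crux stmt-ResolutionOfSingularities-15640 (`WildQuotientResolution`), registered stub `stub_phaseZeroHighDim`.
After ✓`PrincipalizationReduction.phaseZero_conclusion_of_named` the stub's VERBATIM conclusion follows from
(H1) `Literature.AlgebraicGeometry.Ramification.AbbesSaito2011_inertiaNormalSylow_after_admissibleBlowup`
(Abbes–Saito 2011, Prop. 2.22: a theorem in print, not yet ported) and (H3*) `EquivariantPrincipalization`.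
The printed proof of 2.22 (arXiv:1007.3873v3, 2.16–2.22) runs a tower of `U`-admissible blow-ups and
NORMALISATIONS and needs, to present the tower as ONE `U`-admissible blow-up, its Prop. 2.16:

> "Let `A` be a ring, `t ∈ A`, `X = Spec(A)`, `U = Spec(A_t)`, `B` a finite sub-`A`-algebra of `A_t` and
> `Y = Spec(B)`. Assume that `t` is not a zero divisor in `A`. Then the canonical morphism `Y → X` is a
> `U`-admissible blow-up."

This file is the commutative ALGEBRA of a chart-free proof through the universal property of blow-ups
(the scheme-level statement is in the companion file `…FiniteModificationBlowup.lean`). Writing the generators of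
`B` as `fᵢ = aᵢ / tʳ` and `J = (tʳ, a₁, …, aₙ)`:

* `exists_common_denominator_relations` — a common denominator `tʳ` (`r ≥ 1`) and, for each `aᵢ`, the
  integral equation of `fᵢ` with roots scaled by `tʳ` (Mathlib `Polynomial.scaleRoots`):
  `aᵢ^m + Σ_{k<m} q_k (tʳ)^{m-k} aᵢ^k = 0`;
* `generator_of_integral_relations` (KEY): if `φ : R → S` makes `J S = (u)` with `u` regular, then `φ(tʳ)` is
  regular, generates `J S`, and divides each `φ(aᵢ)`. (`φ(tʳ) = c u`, `φ(aᵢ) = cᵢ u`, `(c, c₁, …, cₙ) = S`;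
  the scaled equations give `cᵢ^m ∈ (c)` after cancelling `u^m`, so `√(c) = S` and `c` is a unit.)
* `ringHom_ext_adjoin`, `exists_ringHom_adjoin` — `φ` extends UNIQUELY to `B = R[s] → S` once `φ(t)` is regular
  and `φ(tʳ) g_x = φ(a_x)`: through the localisation `R[1/t] → S[1/φ t]`, whose restriction to `B` lands in
  `S ↪ S[1/φ t]`.

[OURS · crux stmt-ResolutionOfSingularities-15640 · helper toward `stub_phaseZeroHighDim` (first brick of
the port of the named fact (H1) = Abbes–Saito 2011 Prop. 2.22; NOT a proof of the stub); counted 0;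
AI-level work, weaker than expert review.] [cite: AbbesSaito2011, Prop. 2.16] (classical commutative algebra) [folklore]
-/

-- single-problem summit: the doubled namespace component `ResolutionOfSingularities` is forced
set_option linter.dupNamespace false

noncomputable section

open Polynomial

namespace Summit.ResolutionOfSingularities.ResolutionOfSingularities.Theorems.WildQuotientResolution.FiniteModificationBlowup

/-! ## The key algebra: on a Cartier chart, `tʳ` generates `J` and is regular -/

/-- `(c u)^{m-k} (d u)^k = c^{m-k} d^k u^m` for `k ≤ m`. [folklore] -/
theorem mul_pow_mul_mul_pow {S : Type*} [CommRing S] (c d u : S) {m k : ℕ} (hk : k ≤ m) :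
    (c * u) ^ (m - k) * (d * u) ^ k = c ^ (m - k) * d ^ k * u ^ m := by
  obtain ⟨j, rfl⟩ := Nat.exists_eq_add_of_le hk
  rw [Nat.add_sub_cancel_left]
  ring

/-- A power of an element is regular only if the element is. [folklore] -/
theorem mem_nonZeroDivisors_of_pow_mem {S : Type*} [CommRing S] {x : S} {n : ℕ} (hn : 0 < n)
    (hx : x ^ n ∈ nonZeroDivisors S) : x ∈ nonZeroDivisors S := by
  obtain ⟨k, rfl⟩ := Nat.exists_eq_add_of_le hn
  refine mem_nonZeroDivisors_iff_right.mpr fun y hy => mem_nonZeroDivisors_iff_right.mp hx y ?_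
  rw [pow_add, pow_one, ← mul_assoc, hy, zero_mul]

/-- **Key algebra of AS 2.16 via the universal property.** Let `φ : R → S`, `J = (tʳ, a₁, …, aₙ)`,
and suppose each `aᵢ` satisfies a "cleared" integral equation
`aᵢ^m + Σ_{k<m} q_k (tʳ)^{m-k} aᵢ^k = 0` (i.e. `aᵢ/tʳ` is integral over `R`). If `J S = (u)` with `u`
regular, then `φ(tʳ)` is regular, generates `J S`, and divides every `φ(aᵢ)`. [folklore]
[cite: AbbesSaito2011, Prop. 2.16 (proof)] -/
theorem generator_of_integral_relations {R S : Type*} [CommRing R] [CommRing S] (φ : R →+* S)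
    (t : R) (r : ℕ) {ι : Type*} (a : ι → R) (m : ι → ℕ) (q : ι → ℕ → R)
    (hrel : ∀ i, a i ^ m i + ∑ k ∈ Finset.range (m i), q i k * (t ^ r) ^ (m i - k) * a i ^ k = 0)
    {u : S} (hu : u ∈ nonZeroDivisors S)
    (hJ : (Ideal.span (insert (t ^ r) (Set.range a))).map φ = Ideal.span {u}) :
    φ (t ^ r) ∈ nonZeroDivisors S ∧ Ideal.span {u} = Ideal.span {φ (t ^ r)} ∧
      ∀ i, ∃ g : S, φ (t ^ r) * g = φ (a i) := by
  -- `φ(tʳ) = c u`, `φ(aᵢ) = cᵢ u`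
  have hmem : ∀ x ∈ insert (t ^ r) (Set.range a), φ x ∈ Ideal.span {u} := fun x hx => by
    rw [← hJ]; exact Ideal.mem_map_of_mem φ (Ideal.subset_span hx)
  obtain ⟨c, hc⟩ := Ideal.mem_span_singleton'.mp (hmem _ (Set.mem_insert _ _))
  choose cc hcc using
    fun i => Ideal.mem_span_singleton'.mp (hmem _ (Set.mem_insert_of_mem _ ⟨i, rfl⟩))
  -- (1) `(c, c₁, …, cₙ) = S`
  let K : Ideal S := Ideal.span (insert c (Set.range cc))
  have hK : K = ⊤ := by
    have hle : (Ideal.span (insert (t ^ r) (Set.range a))).map φ ≤ Ideal.span {u} * K := by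
      rw [Ideal.map_span]
      refine Ideal.span_le.mpr ?_
      rintro _ ⟨x, hx, rfl⟩
      rcases hx with rfl | ⟨i, rfl⟩
      · rw [← hc, mul_comm c u]
        exact Ideal.mul_mem_mul (Ideal.mem_span_singleton_self u)
          (Ideal.subset_span (Set.mem_insert _ _))
      · rw [← hcc i, mul_comm (cc i) u]
        exact Ideal.mul_mem_mul (Ideal.mem_span_singleton_self u)
          (Ideal.subset_span (Set.mem_insert_of_mem _ ⟨i, rfl⟩))
    have huK : u ∈ Ideal.span {u} * K := hle (hJ ▸ Ideal.mem_span_singleton_self u)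
    obtain ⟨z, hzK, hz⟩ := Ideal.mem_span_singleton_mul.mp huK
    have hz1 : z = 1 := by
      have h0 : (z - 1) * u = 0 := by rw [sub_mul, one_mul, mul_comm, hz, sub_self]
      exact sub_eq_zero.mp (mem_nonZeroDivisors_iff_right.mp hu _ h0)
    exact Ideal.eq_top_of_isUnit_mem K (hz1 ▸ hzK) isUnit_one
  -- (2) `cᵢ ∈ √(c)`: apply `φ` to the integral relation and cancel `u^m`
  have hrad : ∀ i, cc i ∈ (Ideal.span {c}).radical := by
    intro i
    refine ⟨m i, ?_⟩
    have h := congrArg φ (hrel i)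
    simp only [map_add, map_pow, map_sum, map_mul, map_zero, ← hc, ← hcc i] at h
    have h' : (cc i ^ m i + ∑ k ∈ Finset.range (m i), φ (q i k) * c ^ (m i - k) * cc i ^ k) *
        u ^ m i = 0 := by
      rw [← h, add_mul, Finset.sum_mul, mul_pow]
      congr 1
      refine Finset.sum_congr rfl fun k hk => ?_
      conv_rhs => rw [mul_assoc, mul_pow_mul_mul_pow c (cc i) u (Finset.mem_range.mp hk).le]
      ring
    have h'' := mem_nonZeroDivisors_iff_right.mp (pow_mem hu (m i)) _ h'
    rw [eq_neg_of_add_eq_zero_left h'']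
    refine neg_mem (Ideal.sum_mem _ fun k hk => ?_)
    exact Ideal.mul_mem_right _ _ (Ideal.mul_mem_left _ _ (Ideal.pow_mem_of_mem _
      (Ideal.mem_span_singleton_self c) _ (Nat.sub_pos_of_lt (Finset.mem_range.mp hk))))
  -- (3) `c` is a unit
  have hcunit : IsUnit c := by
    rw [← Ideal.span_singleton_eq_top, ← Ideal.radical_eq_top, eq_top_iff, ← hK]
    refine Ideal.span_le.mpr ?_
    rintro _ (rfl | ⟨i, rfl⟩)
    · exact Ideal.le_radical (Ideal.mem_span_singleton_self _)
    · exact hrad i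
  refine ⟨?_, ?_, fun i => ?_⟩
  · rw [← hc]; exact mul_mem hcunit.mem_nonZeroDivisors hu
  · rw [← hc]; exact (Ideal.span_singleton_mul_left_unit hcunit u).symm
  · obtain ⟨ci, hci⟩ := hcunit
    refine ⟨↑ci⁻¹ * cc i, ?_⟩
    rw [← hc, ← hcc i, ← hci]
    calc (ci : S) * u * (↑ci⁻¹ * cc i) = (ci : S) * ↑ci⁻¹ * (cc i * u) := by ring
      _ = cc i * u := by rw [Units.mul_inv, one_mul]

/-! ## Extending `R → S` along `R ⊆ B ⊆ R[1/t]` -/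

/-- **Uniqueness of the extension.** Two ring maps `B = R[s] → S` (`s ⊆ R[1/t]` with
`x tʳ = a_x ∈ R` for `x ∈ s`) extending `φ : R → S` coincide as soon as `φ(tʳ)` is regular. [folklore] -/
theorem ringHom_ext_adjoin {R S : Type*} [CommRing R] [CommRing S] (φ : R →+* S) (t : R) (r : ℕ)
    (hreg : φ (t ^ r) ∈ nonZeroDivisors S) (s : Set (Localization.Away t)) (a : s → R)
    (hfa : ∀ x : s, (x : Localization.Away t) * algebraMap R _ (t ^ r) = algebraMap R _ (a x))
    (ψ₁ ψ₂ : Algebra.adjoin R s →+* S) (h₁ : ψ₁.comp (algebraMap R _) = φ)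
    (h₂ : ψ₂.comp (algebraMap R _) = φ) : ψ₁ = ψ₂ := by
  have hxs : ∀ x : s, (x : Localization.Away t) ∈ Algebra.adjoin R s :=
    fun x => Algebra.subset_adjoin x.2
  have hgen : ∀ x : s, ψ₁ ⟨x, hxs x⟩ = ψ₂ ⟨x, hxs x⟩ := by
    intro x
    have hB : (⟨x, hxs x⟩ : Algebra.adjoin R s) * algebraMap R _ (t ^ r) = algebraMap R _ (a x) :=
      Subtype.ext (hfa x)
    have e₁ : ψ₁ ⟨x, hxs x⟩ * φ (t ^ r) = φ (a x) := by
      rw [← h₁, RingHom.comp_apply, RingHom.comp_apply, ← map_mul, hB]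
    have e₂ : ψ₂ ⟨x, hxs x⟩ * φ (t ^ r) = φ (a x) := by
      rw [← h₂, RingHom.comp_apply, RingHom.comp_apply, ← map_mul, hB]
    have h0 : (ψ₁ ⟨x, hxs x⟩ - ψ₂ ⟨x, hxs x⟩) * φ (t ^ r) = 0 := by
      rw [sub_mul, e₁, e₂, sub_self]
    exact sub_eq_zero.mp (mem_nonZeroDivisors_iff_right.mp hreg _ h0)
  ext ⟨b, hb⟩
  induction hb using Algebra.adjoin_induction with
  | mem x hx => exact hgen ⟨x, hx⟩
  | algebraMap x =>
    have e₁ := congrArg (fun h => h x) h₁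
    have e₂ := congrArg (fun h => h x) h₂
    simp only [RingHom.comp_apply] at e₁ e₂
    exact e₁.trans e₂.symm
  | add x y hx hy ihx ihy =>
    have : (⟨x + y, add_mem hx hy⟩ : Algebra.adjoin R s) = ⟨x, hx⟩ + ⟨y, hy⟩ := rfl
    rw [this, map_add, map_add, ihx, ihy]
  | mul x y hx hy ihx ihy =>
    have : (⟨x * y, mul_mem hx hy⟩ : Algebra.adjoin R s) = ⟨x, hx⟩ * ⟨y, hy⟩ := rfl
    rw [this, map_mul, map_mul, ihx, ihy]

/-- **Existence of the extension.** If `φ(t)` is regular and `φ(tʳ) g_x = φ(a_x)` (`x ∈ s`), then `φ`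
extends to `B = R[s] ⊆ R[1/t]` (`x tʳ = a_x`) with `x ↦ g_x`: through the localisation
`R[1/t] → S[1/φ t]`, whose restriction to `B` lands in `S ↪ S[1/φ t]`. [folklore] -/
theorem exists_ringHom_adjoin {R S : Type*} [CommRing R] [CommRing S] (φ : R →+* S) (t : R)
    (hφt : φ t ∈ nonZeroDivisors S) (s : Set (Localization.Away t)) (a : s → R) (r : ℕ)
    (hfa : ∀ x : s, (x : Localization.Away t) * algebraMap R _ (t ^ r) = algebraMap R _ (a x))
    (g : s → S) (hg : ∀ x, φ (t ^ r) * g x = φ (a x)) :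
    ∃ ψ : Algebra.adjoin R s →+* S, ψ.comp (algebraMap R _) = φ ∧
      ∀ x : s, ψ ⟨x, Algebra.subset_adjoin x.2⟩ = g x := by
  let L := Localization.Away t
  let S' := Localization.Away (φ t)
  have hinj : Function.Injective (algebraMap S S') :=
    IsLocalization.injective S' (Submonoid.powers_le.mpr hφt)
  have hunit : IsUnit (((algebraMap S S').comp φ) t) := IsLocalization.Away.algebraMap_isUnit (φ t)
  let Λ : L →+* S' := IsLocalization.Away.lift t hunit
  have hΛ : ∀ x : R, Λ (algebraMap R L x) = algebraMap S S' (φ x) := fun x =>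
    IsLocalization.Away.lift_eq t hunit x
  have hΛs : ∀ x : s, Λ x = algebraMap S S' (g x) := by
    intro x
    have h1 : algebraMap S S' (φ (t ^ r)) * Λ x =
        algebraMap S S' (φ (t ^ r)) * algebraMap S S' (g x) := by
      rw [← map_mul, hg, ← hΛ, ← hΛ, mul_comm, ← map_mul, hfa]
    have hu : IsUnit (algebraMap S S' (φ (t ^ r))) := by
      rw [map_pow, map_pow]; exact (IsLocalization.Away.algebraMap_isUnit (φ t)).pow r
    exact hu.mul_left_cancel h1
  have hrange : ∀ b ∈ Algebra.adjoin R s, Λ b ∈ (algebraMap S S').range := by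
    intro b hb
    induction hb using Algebra.adjoin_induction with
    | mem x hx => exact ⟨g ⟨x, hx⟩, (hΛs ⟨x, hx⟩).symm⟩
    | algebraMap x => exact ⟨φ x, (hΛ x).symm⟩
    | add x y _ _ hx hy => rw [map_add]; exact add_mem hx hy
    | mul x y _ _ hx hy => rw [map_mul]; exact mul_mem hx hy
  let e : S ≃+* (algebraMap S S').range := RingEquiv.ofBijective (algebraMap S S').rangeRestrict
    ⟨fun x y hxy => hinj (congrArg Subtype.val hxy), RingHom.rangeRestrict_surjective _⟩
  have he : ∀ y, algebraMap S S' (e.symm y) = (y : S') := fun y => by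
    change (((e (e.symm y)) : (algebraMap S S').range) : S') = (y : S')
    rw [e.apply_symm_apply]
  let Λ' : Algebra.adjoin R s →+* (algebraMap S S').range :=
    (Λ.comp (Algebra.adjoin R s).val.toRingHom).codRestrict _ fun b => hrange b b.2
  refine ⟨e.symm.toRingHom.comp Λ', ?_, fun x => ?_⟩
  · ext x
    apply hinj
    change algebraMap S S' (e.symm (Λ' (algebraMap R _ x))) = _
    rw [he]
    exact hΛ x
  · apply hinj
    change algebraMap S S' (e.symm (Λ' _)) = _
    rw [he]
    exact hΛs x

/-! ## Common denominators and cleared integral equations -/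

/-- **Common denominator and cleared integral equations** for finitely many elements of `R[1/t]`
integral over `R` (`t` regular): `fᵢ tʳ = aᵢ` with one `r ≥ 1`, and each `aᵢ` satisfies
`aᵢ^m + Σ_{k<m} q_k (tʳ)^{m-k} aᵢ^k = 0` (the integral equation of `fᵢ` with roots scaled by `tʳ`,
Mathlib `Polynomial.scaleRoots`). [folklore] -/
theorem exists_common_denominator_relations {R : Type*} [CommRing R] (t : R)
    (ht : t ∈ nonZeroDivisors R) {ι : Type*} [Finite ι] (f : ι → Localization.Away t)
    (hf : ∀ i, IsIntegral R (f i)) :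
    ∃ (r : ℕ) (a : ι → R) (m : ι → ℕ) (q : ι → ℕ → R), 0 < r ∧
      (∀ i, f i * algebraMap R _ (t ^ r) = algebraMap R _ (a i)) ∧
      ∀ i, a i ^ m i + ∑ k ∈ Finset.range (m i), q i k * (t ^ r) ^ (m i - k) * a i ^ k = 0 := by
  let L := Localization.Away t
  have hinj : Function.Injective (algebraMap R L) :=
    IsLocalization.injective L (Submonoid.powers_le.mpr ht)
  haveI := Fintype.ofFinite ι
  -- denominators
  have hden : ∀ i, ∃ (n : ℕ) (a₀ : R), f i * algebraMap R L (t ^ n) = algebraMap R L a₀ := by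
    intro i
    obtain ⟨⟨a₀, ⟨_, n, rfl⟩⟩, h⟩ := IsLocalization.surj (Submonoid.powers t) (f i)
    exact ⟨n, a₀, h⟩
  choose n a₀ ha₀ using hden
  let r : ℕ := Finset.univ.sup n + 1
  have hnr : ∀ i, n i ≤ r := fun i => (Finset.le_sup (Finset.mem_univ i)).trans (Nat.le_succ _)
  let a : ι → R := fun i => a₀ i * t ^ (r - n i)
  have hfa : ∀ i, f i * algebraMap R L (t ^ r) = algebraMap R L (a i) := by
    intro i
    have : t ^ r = t ^ n i * t ^ (r - n i) := by rw [← pow_add, Nat.add_sub_cancel' (hnr i)]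
    rw [this, map_mul, ← mul_assoc, ha₀ i, ← map_mul]
  -- cleared integral equations
  have hrel : ∀ i, ∃ (m : ℕ) (q : ℕ → R),
      a i ^ m + ∑ k ∈ Finset.range m, q k * (t ^ r) ^ (m - k) * a i ^ k = 0 := by
    intro i
    obtain ⟨P, hP, hP0⟩ := hf i
    have hP0' : aeval (f i) P = 0 := hP0
    have hQ0 : (P.scaleRoots (t ^ r)).eval (a i) = 0 := by
      apply hinj
      rw [map_zero, ← aeval_algebraMap_apply_eq_algebraMap_eval, ← hfa i, mul_comm]
      exact scaleRoots_aeval_eq_zero hP0'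
    refine ⟨P.natDegree, fun k => P.coeff k, ?_⟩
    rw [eval_eq_sum_range, natDegree_scaleRoots, Finset.sum_range_succ, coeff_scaleRoots,
      Nat.sub_self, pow_zero, mul_one, hP.coeff_natDegree, one_mul, add_comm] at hQ0
    rw [← hQ0]
    congr 1
    refine Finset.sum_congr rfl fun k _ => ?_
    rw [coeff_scaleRoots]
  choose m q hmq using hrel
  exact ⟨r, a, m, q, Nat.succ_pos _, hfa, hmq⟩


end Summit.ResolutionOfSingularities.ResolutionOfSingularities.Theorems.WildQuotientResolution.FiniteModificationBlowup

end
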